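import Summits.AtomisticToContinuum.Crystallization.Theorems.ChartedZeroExcessLayeredLatticeLiouvilleS

/-!
# Zero-excess layered lattice Liouville — part T (lens-2 g32, node «MultiScaleHarmonicApprox»): the residual-designate (A) RE-TYPED to what the
iteration supplies, then CUT into four pieces with the bad-set regularity (A1) as the ONE named residual

Target of record (critic row 525, VERBATIM decl of part R): `HarmonicApproxPGL aHi Λ θ s` (A).  Column instance `(aHi; Λ, θ, s, s') =
(1; 2, 1/16, 1/50, 1/25)`.

## THE FINDING THAT DRIVES THE CUT («single-scale is not what the iteration has»)
The upstream consumer of H♭ is `flatnessUpgradePG_of_halvingBasin` (part M): it iterates `η ↦ η/2` at FIXED radius down to EXACT flatness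
(`AsymptoticallyLayerFlat = ∃ R₀ ∀ ε`, snapped to translates by `exactEndgame_of_le`).  So the super-flat corner `η → 0` at fixed `R` of (A) is
load-bearing — and there the far field of the exterior (sources beyond the window, NOT registered) is slaved to `η` only in `H⁻¹` and has an ABSOLUTE
analytic floor `~R⁻⁴`: a floor-tolerant (A) breaks the endgame, a single-scale (A) asks for an estimate nobody can supply in that corner.  BUT the same
induction proves `κ₀·2⁻ᵏ`-flatness at EVERY radius `≥ max R₀ R₁` SIMULTANEOUSLY (its `iter`), so the MULTI-SCALE hypothesis «flat at every radius
`R' ≥ M·R`» is available for free.  §V.1 re-types the one John leaf accordingly — `HalvingBasinPGms` (hypothesis `∀ R' ≥ M·R`), with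
`flatnessUpgradePG_of_halvingBasinPGms` PROVED by the same induction and the seam `HalvingBasinPG → HalvingBasinPGms` PROVED — and threads the
multi-scale hypothesis down the column of record: `HalvingBasinPGLms ⟸ (P) ∧ HarmonicDecayPGLms ∧ (C)`, `HarmonicDecayPGLms ⟸ (T) ∧ (U) ∧ (Ams) ∧ (D)`,
all PROVED, every seam «single-scale ⇒ multi-scale» PROVED (nothing lost: any proof of (A) still closes the column).  Under multi-scale registration the
WHOLE exterior is perturbative: the tail force is slaved (`∝ √η`) with powers of `R` to burn, and the shrink factor `M` no longer has to buy anything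
(`M := 64` fixed), which also dissolves the quantifier tension of (A) (`∃ ϱ` before `∃ M`, while a tail range `ϱ(c', M)` was needed).

## THE NODE AND ITS CUT
  (Ams) `HarmonicApproxPGLms aHi Λ θ s`  ⟸  (A0) `GlobalChartRegistrationP`  ∧  (A1) `WildReRegistrationPG`  ∧  (A2) `TameHarmonicApproxP`  ∧  (FF) `TailForceSlavingP`
  — `harmonicApproxPGLms_of_four_pieces`, PROVED (0 sorry): a THIN/FAT case split (the lens) plus threading of constants.

| piece | door | currency (all over EXPLICIT data `(L, w, Ψ)`, so the pieces compose) | type | status / tag | size |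
|---|---|---|---|---|---|
| (A0) `GlobalChartRegistrationP` | `IsDoorSetP` (GSC-free) | multi-scale registered ⇒ ONE equilibrium chart with S's own Hägg word + a GLOBAL bijective, two-sided tear-free registration, level `Cg·η·(D/R)` at every scale `D ≥ R` (`IsGlobalReg`) | REGISTRATION (graph) | WEAKER · TRUE-type · ATTACKABLE | M |
| (A1) `WildReRegistrationPG` | `IsDoorSetPG` | FAT windows only (`K₀ ≤ η·nK`): re-register so that the ϑ-wild bonds carry `≤ εw·η·nK` (`wildMass`) | ε-REGULARITY OF THE BAD SET | **RESIDUAL** · UNDECIDED · TRUE-type · IDEA-NEEDED | L |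
| (A2) `TameHarmonicApproxP` | `IsDoorSetP` (GSC-free: Nash force balance is the tree theorem `hasSum_pairForce_of_isNash`) | (T) → (U) → globally registered + ϑ-sparse + tail-force dual-small ⇒ `IsHarmSplit` at `R/M`, `∀ M ≥ 64 ∃ C(M)` | LINEARISATION (energy identity, coercivity (U) − (T)) | WEAKER · TRUE-type · ATTACKABLE | M–L |
| (FF) `TailForceSlavingP` | `IsDoorSetP` (GSC-free) | globally registered ⇒ `FarDualSmall εf ϱ η R`: the force from everything beyond model distance `ϱ` is `≤ εf·√(η·nK)·‖δφ‖` in duality | LJ LATTICE SUMS (pure analysis) | WEAKER · TRUE-type · ATTACKABLE | M |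

THIN/FAT (the structural dichotomy, built into the glue): on a THIN window (`Cg·η·nK(win R) < ϑ²`) every bond distortion is `≤ τ x ≤ √(Σ τ²) < ϑ`, so
`wildMass ϑ = 0` PROVABLY (`wildMass_eq_zero_of_registered`) and (A1) is not invoked; on a FAT window (A1) re-registers.  Hence (A1) carries the
hypothesis `K₀ ≤ η·nK` for EVERY `K₀ > 0` — strictly weaker than an unrestricted bad-set statement, and exactly the regime where hot spots can exist.

## WHY (A1) IS A RE-REGISTRATION AND NOT A PROPERTY OF ALL REGISTRATIONS (typing-forced)
Over `∀ Ψ` the sparsity claim is FALSE: a registration may SWAP the images of two neighbouring atoms (still bijective, still tear-free at `4 ↦ 8`),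
each swap costs `τ² ≈ 8` at two sites, and a fat budget `Cg·η·nK ≥ 8` pays for `Cg·η·nK/8` swaps — wild fraction `~1`.  So (A1) outputs a NEW
registration `Ψ'` (same chart) whose constant `Cg'` depends on `(δ, a, Cg)` ONLY (else circular with (A2)'s `C`, which is chosen before `c'`).

## GLUE CONSTANTS (proof of `harmonicApproxPGLms_of_four_pieces`)
`Cg ← (A0)(δ,a)`; `Cg' ← (A1)(δ,a,Cg)`; `C := max C_t C_f` with `C_t ← (A2)(δ,a,Cg,64)`, `C_f ← (A2)(δ,a,Cg',64)`.  Given `c', ϱ₁`: (A2) twice gives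
`(ϑ_t, εw_t, εf_t, ϱ₂ᵗ)` and `(ϑ_f, εw_f, εf_f, ϱ₂ᶠ)`; (FF) at `εf_t` (constant `Cg`) and at `εf_f` (constant `Cg'`) gives `ϱ₀ᵗ, ϱ₀ᶠ`;
`ϱ := max (max ϱ₂ᵗ ϱ₂ᶠ) (max ϱ₀ᵗ ϱ₀ᶠ)`; `M := 64`; `K₀ := ϑ_t² / (2·Cg)`; (A1) at `(ϑ_f, εw_f, K₀)`; ceiling = min of six, floor = max of six.
Then per `(S, η, R)`: (A0) ⇒ `(L, w, Ψ)`; `η·nK < K₀` ⇒ wild mass `0` ⇒ (FF)+(A2) at `Cg`; `K₀ ≤ η·nK` ⇒ (A1) ⇒ `Ψ'` ⇒ (FF)+(A2) at `Cg'`; `IsHarmSplit.mono`.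

## WHY EACH PIECE IS STRICTLY SMALLER THAN (Ams), AND NONE IS (A) IN COSTUME
(A0) never produces a harmonic field or a defect: it upgrades per-scale registrations to one global graph registration (door `IsCharted` = global
bond-graph isomorphism with a Barlow stacking; affine-fit rigidity across consecutive scales gives the drift `≤ j·C√η`; equilibrium heights exist for
every word).  (FF) never sees minimality, Nash or a harmonic field: it is an estimate on LJ lattice sums over a registered configuration (Newton's
third law symmetrises BOTH the linear tail and the Taylor remainder `|r| ≤ C D⁻⁸|Δξ|`, dyadic shells `D⁻⁸`, discrete Poincaré/Hardy on windows).
(A2) assumes sparsity and tail smallness as typed hypotheses and contributes only the linear step (energy identity for `u − h`, `h` := the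
`K_ϱ`-harmonic extension on the image of `win (R/2)`, coercive by (U) − (T); tame Taylor term `≤ Cϑ²η·nK`, wild term `≤ C(εw + √εw)η·nK`, `C(M) =
C·M³` absorbs the level of `h` on the `8ρ`-ball WITHOUT an interior estimate).  (A1) is the ε-regularity of the bad set and nothing else.
Probes (`g32/bc/probes_g32T.lean`): each piece ⇏ (Ams), (Ams) ⇏ (A1), no piece provable/refutable outright by the standard batteries (MUST-FAIL).

0 EQUIV.  Every new `def` is a `Prop`, a `Prop`-valued predicate or an `ℝ`/`E3`-valued functional; no instance / notation / set_option.
-/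

noncomputable section

open scoped BigOperators InnerProductSpace RealInnerProductSpace
open MeasureTheory Set Metric Filter Topology
open Summit.AtomisticToContinuum.Crystallization.Theorems.ChartedPlanarOrderRigidityDoor
  (E3 IsClean IsNash IsCharted IsEStarGSC VisibleGap PertRegime atomsIn siteEnergy eStar BindingSurface)
open Summit.AtomisticToContinuum.Crystallization.Theorems.ChartedPlanarOrderDensityDichotomy (μS IsSep nK nK_nonneg excess)
open Summit.AtomisticToContinuum.Crystallization.Theorems.ChartedPlanarOrderMesoCut (IsDoorSet NearHom LayeredHom EnvClose)
open Summit.AtomisticToContinuum.Crystallization.Theorems.OverbindingBudgetLiouvilleDictionary (NearHomBD)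
open Summit.AtomisticToContinuum.Crystallization.Theorems.ChartedPlanarOrderDoorLayered
  (TwoPeriodic DoorPeriodic PeriodicBulkGapDoor gap_and_pert_1_50_of_periodic NearHomL2BD nearHomL2BD_mono nearHomBD_of_nearHomL2BD
   sq_le_finsum_mem not_nearHomL2BD_singleton envClose_mono Layered layeredHom_eq_layered atomsIn_subset)
open Summit.AtomisticToContinuum.Crystallization.Theorems.ChartedPlanarOrderDoorLayeredOsc (IsTwoShellAffineGood DoorPeriodicOsc)
open Summit.AtomisticToContinuum.Crystallization.Theorems.ChartedPlanarOrderCleanScaleP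
  (IsCleanP IsDoorSetP DoorPeriodicP isDoorSetP_mono doorPeriodic_of_doorPeriodicP isDoorSetP_one_iff doorPeriodicP_one_iff)
open Summit.AtomisticToContinuum.Crystallization.Theorems.ChartedPlanarOrderProfileSlavingLJ (pairForce)
open Literature.MathematicalPhysics.StatisticalMechanics (haggLabel barlowOffset layerNormal IsHaggSeq triangularVec₁ triangularVec₂)

namespace Summit.AtomisticToContinuum.Crystallization.Theorems.ChartedZeroExcessLayeredLatticeLiouville

/-! ## §V.1  The multi-scale John leaf and its column (all glue PROVED) -/

/-- ★ **H♭_G^ms «HalvingBasinPGms aHi Λ θ»** — part M's one-step ε-regularity leaf H♭_G with the flatness hypothesis at EVERY radius `R' ≥ M·R`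
(same level `η`), which is exactly what the iteration `flatnessUpgradePG_of_halvingBasin` has in hand at every stage.  H♭_G ⇒ H♭_G^ms (PROVED,
`halvingBasinPGms_of_halvingBasinPG`); U_G ⟸ H♭_G^ms (PROVED, `flatnessUpgradePG_of_halvingBasinPGms`). [this file, g32] -/
def HalvingBasinPGms (aHi Λ θ : ℝ) : Prop :=
  LatticeLiouvilleCert → LayeredLiouvilleCert → ∀ δ : ℝ, 0 < δ → ∃ κ₀ : ℝ, 0 < κ₀ ∧ ∃ M : ℝ, 1 ≤ M ∧ ∃ R₀ : ℝ, 0 < R₀ ∧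
    ∀ S : Set E3, IsDoorSetPG aHi δ S → (∀ q ∈ S, IsTwoShellAffineGood θ S q) →
      ∀ η : ℝ, 0 < η → η ≤ κ₀ → ∀ R : ℝ, R₀ ≤ R →
        (∀ R' : ℝ, M * R ≤ R' → NearHomL2BD Λ η 4 S (atomsIn (μS S) 0 R')) → NearHomL2BD Λ (η / 2) 4 S (atomsIn (μS S) 0 R)

/-- ★ **H♭^ℓ,ms «HalvingBasinPGLms aHi Λ θ s»** — part PB's rigid-chart John leaf H♭^ℓ with the multi-scale hypothesis: «`η`-flat under an
`s`-conformal chart about `a` at EVERY radius `R' ≥ M·R` ⇒ `η/2`-flat at radius `R`».  H♭^ℓ ⇒ H♭^ℓ,ms (PROVED). [this file, g32] -/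
def HalvingBasinPGLms (aHi Λ θ s : ℝ) : Prop :=
  LatticeLiouvilleCert → LayeredLiouvilleCert → ∀ δ : ℝ, 0 < δ → ∀ a : ℝ, 0 < a → ∃ κ₀ : ℝ, 0 < κ₀ ∧ ∃ M : ℝ, 1 ≤ M ∧ ∃ R₀ : ℝ, 0 < R₀ ∧
    ∀ S : Set E3, IsDoorSetPG aHi δ S → (∀ q ∈ S, IsTwoShellAffineGood θ S q) →
      ∀ η : ℝ, 0 < η → η ≤ κ₀ → ∀ R : ℝ, R₀ ≤ R →
        (∀ R' : ℝ, M * R ≤ R' → NearHomL2BDL a s Λ η 4 S (atomsIn (μS S) 0 R')) → NearHomL2BD Λ (η / 2) 4 S (atomsIn (μS S) 0 R)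

/-- seam: H♭_G ⇒ H♭_G^ms (the multi-scale leaf is the weaker statement). [this file, g32] -/
theorem halvingBasinPGms_of_halvingBasinPG {aHi Λ θ : ℝ} (h : HalvingBasinPG aHi Λ θ) : HalvingBasinPGms aHi Λ θ := by
  intro hL hL' δ hδ
  obtain ⟨κ₀, hκ₀, M, hM, R₀, hR₀, hstep⟩ := h hL hL' δ hδ
  exact ⟨κ₀, hκ₀, M, hM, R₀, hR₀, fun S hS hg η hη hηle R hR hflat => hstep S hS hg η hη hηle R hR (hflat (M * R) le_rfl)⟩

/-- seam: H♭^ℓ ⇒ H♭^ℓ,ms. [this file, g32] -/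
theorem halvingBasinPGLms_of_halvingBasinPGL {aHi Λ θ s : ℝ} (h : HalvingBasinPGL aHi Λ θ s) : HalvingBasinPGLms aHi Λ θ s := by
  intro hL hL' δ hδ a ha
  obtain ⟨κ₀, hκ₀, M, hM, R₀, hR₀, hstep⟩ := h hL hL' δ hδ a ha
  exact ⟨κ₀, hκ₀, M, hM, R₀, hR₀, fun S hS hg η hη hηle R hR hflat => hstep S hS hg η hη hηle R hR (hflat (M * R) le_rfl)⟩

/-- ★★ **U_G ⟸ H♭_G^ms (PROVED)** — part M's halving iteration, run with the induction hypothesis at ALL radii above the floor: at stage `k` the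
configuration is `κ₀·2⁻ᵏ`-flat at every radius `≥ max R₀ R₁`, so the multi-scale hypothesis of the step is available. [this file, g32] -/
theorem flatnessUpgradePG_of_halvingBasinPGms {aHi Λ θ : ℝ} (κ : ℝ) (hH : HalvingBasinPGms aHi Λ θ) : FlatnessUpgradePG aHi Λ θ κ := by
  intro hP hL δ hδ S hS hO _hflat hev
  obtain ⟨κ₀, hκ₀, M, hM, R₀, hR₀, hstep⟩ := hH hP hL δ hδ
  obtain ⟨R₁, hR₁⟩ := hev κ₀ hκ₀
  have iter : ∀ k : ℕ, ∀ R : ℝ, max R₀ R₁ ≤ R → NearHomL2BD Λ (κ₀ / 2 ^ k) 4 S (atomsIn (μS S) 0 R) := by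
    intro k
    induction k with
    | zero => intro R hR; simpa using hR₁ R ((le_max_right _ _).trans hR)
    | succ k ih =>
      intro R hR
      have hRnn : 0 ≤ R := hR₀.le.trans ((le_max_left _ _).trans hR)
      have hMR : max R₀ R₁ ≤ M * R := hR.trans (le_mul_of_one_le_left hRnn hM)
      have h1 := hstep S hS hO (κ₀ / 2 ^ k) (by positivity) (div_le_self hκ₀.le (one_le_pow₀ (by norm_num))) R
        ((le_max_left _ _).trans hR) (fun R' hR' => ih R' (hMR.trans hR'))
      rwa [pow_succ, ← div_div]
  refine ⟨max R₀ R₁, fun ε hε R hR => ?_⟩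
  obtain ⟨k, hk⟩ := exists_pow_lt_of_lt_one (div_pos hε hκ₀) (by norm_num : (1 / 2 : ℝ) < 1)
  refine nearHomL2BD_mono ?_ (iter k R hR)
  rw [div_eq_mul_inv, ← inv_pow, show ((2:ℝ)⁻¹) = 1 / 2 by norm_num]
  have := (lt_div_iff₀ hκ₀).1 hk
  linarith [this]

/-- ★ **H♭_G^ms ⟸ Z_L ∧ H♭^ℓ,ms (PROVED)** — part PB's seam, the localisation applied at every radius `R' ≥ M·R ≥ R_z`. [this file, g32] -/
theorem halvingBasinPGms_of_confL {aHi Λ θ s : ℝ} (hZ : ConformalChartLocalisationPG aHi Λ θ s) (hH : HalvingBasinPGLms aHi Λ θ s) :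
    HalvingBasinPGms aHi Λ θ := by
  intro hL hL' δ hδ
  obtain ⟨a, ha, ηz, hηz, Rz, hRz, hZ'⟩ := hZ δ hδ
  obtain ⟨κ₀, hκ₀, M, hM, R₀, hR₀, hS⟩ := hH hL hL' δ hδ a ha
  refine ⟨min κ₀ ηz, lt_min hκ₀ hηz, M, hM, max R₀ Rz, lt_max_of_lt_left hR₀, fun S hSd hg η hη hηle R hR hflat => ?_⟩
  have hR₀R : R₀ ≤ R := (le_max_left _ _).trans hR
  have hRzR : Rz ≤ R := (le_max_right _ _).trans hR
  have hRpos : 0 < R := hRz.trans_le hRzR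
  have hMR : Rz ≤ M * R := hRzR.trans (le_mul_of_one_le_left hRpos.le hM)
  exact hS S hSd hg η hη (hηle.trans (min_le_left _ _)) R hR₀R
    (fun R' hR' => hZ' S hSd hg η hη (hηle.trans (min_le_right _ _)) R' (hMR.trans hR') (hflat R' hR'))

/-- ★ **E_G ⟸ A∞_G ∧ H♭_G^ms (PROVED)**. [this file, g32] -/
theorem flatnessExtinctionPG_of_scale_basinms {aHi Λ θ κ : ℝ} (hA : ScaleExtinctionPG aHi Λ θ κ) (hH : HalvingBasinPGms aHi Λ θ) :
    FlatnessExtinctionPG aHi Λ θ κ :=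
  flatnessExtinctionPG_of_scale_upgrade hA (flatnessUpgradePG_of_halvingBasinPGms κ hH)

/-- ★★ **COLUMN `_16XBGms`** — part N's `_16XBG` with the multi-scale John leaf: `LatticeLiouvilleCert → LayeredLiouvilleCert → R_G → X →
H♭_G^ms(1;2,1/16) → PeriodicBulkGapDoor 2 → VisibleGap (1/50) ∧ PertRegime (1/50)`. [this file, g32] -/
theorem gap_and_pert_1_50_of_certs_16XBGms (hL : LatticeLiouvilleCert) (hL' : LayeredLiouvilleCert)
    (hR : OscRigidityL2BDPG 1 2 (1 / 16) (1 / 16)) (hX : ExcessFlatnessControlP 1 2 (1 / 16) (1 / 16))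
    (hB : HalvingBasinPGms 1 2 (1 / 16)) (hG : PeriodicBulkGapDoor 2) : VisibleGap (1 / 50) ∧ PertRegime (1 / 50) :=
  gap_and_pert_1_50_of_certs_16EG hL hL' hR (flatnessExtinctionPG_of_scale_basinms (scaleExtinctionPG_of_excessControl hX) hB) hG

/-- ★★ **COLUMN `_16XHlms`** — part PB's `_16XHl` with the multi-scale rigid-chart leaf: `… → Z_E → H♭^ℓ,ms(1;2,1/16,1/50) → HBG″ → …`. [this file, g32] -/
theorem gap_and_pert_1_50_of_certs_16XHlms (hL : LatticeLiouvilleCert) (hL' : LayeredLiouvilleCert)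
    (hR : OscRigidityL2BDPG 1 2 (1 / 16) (1 / 16)) (hX : ExcessFlatnessControlP 1 2 (1 / 16) (1 / 16))
    (hE : ExcessChartLocalisationP 1 2 (1 / 16) (1 / 50)) (hB : HalvingBasinPGLms 1 2 (1 / 16) (1 / 50))
    (hG : PeriodicBulkGapDoor 2) : VisibleGap (1 / 50) ∧ PertRegime (1 / 50) :=
  gap_and_pert_1_50_of_certs_16XBGms hL hL' hR hX (halvingBasinPGms_of_confL (conformalChartLocalisationPG_of_excess hE) hB) hG

/-! ## §V.2  The multi-scale decay leaf (HDms) and the two glues above the node (PROVED) -/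

/-- ★ **(HDms) «HarmonicDecayPGLms aHi Λ θ s s'»** — part Q's (HD) with the registered hypothesis at EVERY scale `D ≥ R` (radius = scale, level `η`,
equilibrium `s`-chart per scale): ⇒ registered at `(t·R, c·η)` under an equilibrium `s'`-chart.  (HD) ⇒ (HDms) (PROVED). [this file, g32] -/
def HarmonicDecayPGLms (aHi Λ θ s s' : ℝ) : Prop :=
  LatticeLiouvilleCert → LayeredLiouvilleCert → ∀ δ : ℝ, 0 < δ → ∀ a : ℝ, 0 < a → ∀ c : ℝ, 0 < c →
    ∃ t : ℝ, 0 < t ∧ t ≤ 1 ∧ ∃ η₁ : ℝ, 0 < η₁ ∧ ∃ R₁ : ℝ, 0 < R₁ ∧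
      ∀ S : Set E3, IsDoorSetPG aHi δ S → (∀ q ∈ S, IsTwoShellAffineGood θ S q) →
        ∀ η : ℝ, 0 < η → η ≤ η₁ → ∀ R : ℝ, R₁ ≤ R →
          (∀ D : ℝ, R ≤ D → NearHomH1BDE a s Λ η 4 D S (atomsIn (μS S) 0 D)) →
            NearHomH1BDE a s' Λ (c * η) 4 (t * R) S (atomsIn (μS S) 0 (t * R))

/-- seam: (HD) ⇒ (HDms). [this file, g32] -/
theorem harmonicDecayPGLms_of_harmonicDecayPGL {aHi Λ θ s s' : ℝ} (h : HarmonicDecayPGL aHi Λ θ s s') : HarmonicDecayPGLms aHi Λ θ s s' := by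
  intro hL hL' δ hδ a ha c hc
  obtain ⟨t, ht, ht1, η₁, hη₁, R₁, hR₁, h'⟩ := h hL hL' δ hδ a ha c hc
  exact ⟨t, ht, ht1, η₁, hη₁, R₁, hR₁, fun S hS hg η hη hηle R hR hreg => h' S hS hg η hη hηle R hR (hreg R le_rfl)⟩

/-- ★★ **H♭^ℓ,ms ⟸ (P) ∧ (HDms) ∧ (C) (PROVED)** — part Q's glue with the registration applied at every scale: misfit-flat at every `R' ≥ M·R`
(`M := M_P·M_c/t`) ⇒ registered `C_P·η` at every scale `D ≥ ρ := M_c·R/t` ⇒ (HDms) registered `c·C_P·η` at `t·ρ = M_c·R` ⇒ (C) misfit `η/2` at `R`,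
with `c := 1/(2 C_c C_P)`. [this file, g32] -/
theorem halvingBasinPGLms_of_reg_harm_cacc {aHi Λ θ s s' : ℝ} (hP : RegistrationP aHi Λ θ s) (hH : HarmonicDecayPGLms aHi Λ θ s s')
    (hC : CaccioppoliPGL aHi Λ θ s') : HalvingBasinPGLms aHi Λ θ s := by
  intro hL hL' δ hδ a ha
  obtain ⟨CP, hCP, MP, hMP, ηP, hηP, RP, hRP, hP'⟩ := hP δ hδ a ha
  obtain ⟨Cc, hCc, Mc, hMc, ηc, hηc, Rc, hRc, hC'⟩ := hC δ hδ a ha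
  have hCP0 : 0 < CP := zero_lt_one.trans_le hCP
  have hCc0 : 0 < Cc := zero_lt_one.trans_le hCc
  have hMP0 : 0 < MP := zero_lt_one.trans_le hMP
  have hMc0 : 0 < Mc := zero_lt_one.trans_le hMc
  obtain ⟨t, ht, ht1, η₁, hη₁, R₁, hR₁, hH'⟩ := hH hL hL' δ hδ a ha (1 / (2 * Cc * CP)) (by positivity)
  have hM1 : 1 ≤ MP * Mc / t :=
    (one_le_mul_of_one_le_of_one_le hMP hMc).trans (le_div_self (by positivity) ht ht1)
  refine ⟨min ηP (min (η₁ / CP) (2 * Cc * ηc)), lt_min hηP (lt_min (div_pos hη₁ hCP0) (by positivity)), MP * Mc / t, hM1,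
    max RP (max R₁ Rc), lt_max_of_lt_left hRP, fun S hSd hg η hη hηle R hR hflat => ?_⟩
  have hRP_R : RP ≤ R := (le_max_left _ _).trans hR
  have hR1_R : R₁ ≤ R := ((le_max_left _ _).trans (le_max_right _ _)).trans hR
  have hRc_R : Rc ≤ R := ((le_max_right _ _).trans (le_max_right _ _)).trans hR
  have hR0 : 0 ≤ R := hRc.le.trans hRc_R
  have hRρ : R ≤ Mc * R / t := (le_mul_of_one_le_left hR0 hMc).trans (le_div_self (by positivity) ht ht1)
  -- step (P) at every scale `D ≥ ρ := Mc·R/t`: misfit-flat at `MP·D` ⇒ registered-flat at `D`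
  have hregms : ∀ D : ℝ, Mc * R / t ≤ D → NearHomH1BDE a s Λ (CP * η) 4 D S (atomsIn (μS S) 0 D) := by
    intro D hD
    refine hP' S hSd.1 hg η hη (hηle.trans (min_le_left _ _)) D (hRP_R.trans (hRρ.trans hD)) (hflat (MP * D) ?_)
    calc MP * Mc / t * R = MP * (Mc * R / t) := by ring
      _ ≤ MP * D := mul_le_mul_of_nonneg_left hD hMP0.le
  -- step (HDms): registered-flat at every scale `≥ ρ` ⇒ registered-flat at `t·ρ = Mc·R`, level contracted by `c`
  have hlev1 : CP * η ≤ η₁ := by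
    have h := hηle.trans ((min_le_right _ _).trans (min_le_left _ _))
    rw [le_div_iff₀ hCP0] at h
    linarith
  have h2 := hH' S hSd hg (CP * η) (by positivity) hlev1 (Mc * R / t) (hR1_R.trans hRρ) hregms
  have hrad2 : t * (Mc * R / t) = Mc * R := by field_simp
  rw [hrad2] at h2
  -- step (C): registered-flat at `Mc·R` ⇒ misfit-flat at `R`
  have hlev2 : 1 / (2 * Cc * CP) * (CP * η) ≤ ηc := by
    have h := hηle.trans ((min_le_right _ _).trans (min_le_right _ _))
    have heq : 1 / (2 * Cc * CP) * (CP * η) = η / (2 * Cc) := by field_simp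
    rw [heq, div_le_iff₀ (by positivity)]
    linarith
  have h3 := hC' S hSd hg (1 / (2 * Cc * CP) * (CP * η)) (by positivity) hlev2 R hRc_R h2
  have hfin : Cc * (1 / (2 * Cc * CP) * (CP * η)) = η / 2 := by field_simp
  rw [hfin] at h3
  exact h3

/-- ★ **(Ams) «HarmonicApproxPGLms aHi Λ θ s»** — THE NODE: part R's (A) with the registered hypothesis at EVERY scale `D ≥ R` (what (P) delivers
scale by scale from the multi-scale flatness the iteration has).  Same conclusion as (A): the root window at `R/M` SPLITS into a `ϱ`-truncated-harmonic
model field (level `C·η`, `C` independent of `c'`) plus a defect (level `c'·η`).  (A) ⇒ (Ams) (PROVED, `harmonicApproxPGLms_of_harmonicApproxPGL`);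
(Ams) ⟸ (A0) ∧ (A1) ∧ (A2) ∧ (FF) (PROVED, §V.5).  MINIMALITY + REGISTRATION-type; UNDECIDED · TRUE-type; residual core = (A1).
Why it might fail: only through (A1) — hot spots (O(1)-distorted bond clusters of positive density inside a fat GSC window) would carry a fixed
fraction of the misfit; (A0), (A2), (FF) are expected theorems.
Sources: [giaquinta1984 p.120 Thm 3.1], [DuzaarGrotowski2000], [EMing2006], [Theil2006], [this file §V.3–V.5]. [this file, g32] -/
def HarmonicApproxPGLms (aHi Λ θ s : ℝ) : Prop :=
  TailDominationCert → UniformEquilStability s Λ → LayeredLiouvilleCert →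
    ∀ δ : ℝ, 0 < δ → ∀ a : ℝ, 0 < a → ∃ C : ℝ, 1 ≤ C ∧ ∀ c' : ℝ, 0 < c' → ∀ ϱ₁ : ℝ, 1 ≤ ϱ₁ →
      ∃ ϱ : ℝ, ϱ₁ ≤ ϱ ∧ ∃ M : ℝ, 2 ≤ M ∧ ∃ η₁ : ℝ, 0 < η₁ ∧ ∃ R₁ : ℝ, 0 < R₁ ∧
        ∀ S : Set E3, IsDoorSetPG aHi δ S → (∀ q ∈ S, IsTwoShellAffineGood θ S q) →
          ∀ η : ℝ, 0 < η → η ≤ η₁ → ∀ R : ℝ, R₁ ≤ R →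
            (∀ D : ℝ, R ≤ D → NearHomH1BDE a s Λ η 4 D S (atomsIn (μS S) 0 D)) → NearHarmSplitE a s Λ ϱ (C * η) (c' * η) 4 (R / M) S

/-- seam: (A) ⇒ (Ams) — nothing lost (any proof of part R's (A) closes this node). [this file, g32] -/
theorem harmonicApproxPGLms_of_harmonicApproxPGL {aHi Λ θ s : ℝ} (h : HarmonicApproxPGL aHi Λ θ s) : HarmonicApproxPGLms aHi Λ θ s := by
  intro hT hU hL' δ hδ a ha
  obtain ⟨C, hC, h'⟩ := h hT hU hL' δ hδ a ha
  refine ⟨C, hC, fun c' hc' ϱ₁ hϱ₁ => ?_⟩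
  obtain ⟨ϱ, hϱ, M, hM, η₁, hη₁, R₁, hR₁, h''⟩ := h' c' hc' ϱ₁ hϱ₁
  exact ⟨ϱ, hϱ, M, hM, η₁, hη₁, R₁, hR₁, fun S hS hg η hη hηle R hR hreg => h'' S hS hg η hη hηle R hR (hreg R le_rfl)⟩

/-- ★★ **(HDms) ⟸ (T) ∧ (U) ∧ (Ams) ∧ (D) (PROVED)** — part R's glue verbatim with the multi-scale hypothesis threaded into (Ams): `t₀ := min (1/2)
(c/(2 C_d C_A + c))`, `c' := c t₀³/(2 C_d)`, `t := t₀/M`, ceiling `min η_A (min (η_D/C_A) (η_D/c'))`, floor `max R_A (M R_D)`. [this file, g32] -/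
theorem harmonicDecayPGLms_of_tail_unif_approxms_decay {aHi Λ θ s s' : ℝ} (hT : TailDominationCert) (hU : UniformEquilStability s Λ)
    (hA : HarmonicApproxPGLms aHi Λ θ s) (hD : SplitDecayPL aHi Λ θ s s') : HarmonicDecayPGLms aHi Λ θ s s' := by
  intro _ hL' δ hδ a ha c hc
  obtain ⟨CA, hCA, hA'⟩ := hA hT hU hL' δ hδ a ha
  obtain ⟨Cd, hCd, ϱ₁, hϱ₁, hD'⟩ := hD hT hU hL' δ hδ a ha
  have hCA0 : 0 < CA := zero_lt_one.trans_le hCA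
  set t₀ : ℝ := min (1 / 2) (c / (2 * Cd * CA + c)) with ht₀def
  have ht₀ : 0 < t₀ := lt_min (by norm_num) (div_pos hc (by positivity))
  have ht₀half : t₀ ≤ 1 / 2 := min_le_left _ _
  have ht₀le : t₀ ≤ c / (2 * Cd * CA + c) := min_le_right _ _
  have ht₀one : t₀ ≤ 1 := ht₀half.trans (by norm_num)
  set c' : ℝ := c * t₀ ^ 3 / (2 * Cd) with hc'def
  have hc' : 0 < c' := by positivity
  obtain ⟨ϱ, hϱ, M, hM, ηA, hηA, RA, hRA, hA''⟩ := hA' c' hc' ϱ₁ hϱ₁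
  obtain ⟨ηD, hηD, RD, hRD, hD''⟩ := hD' ϱ hϱ t₀ ht₀ ht₀half
  have hM0 : 0 < M := zero_lt_two.trans_le hM
  have hM1 : 1 ≤ M := one_le_two.trans hM
  refine ⟨t₀ / M, div_pos ht₀ hM0, (div_le_self ht₀.le hM1).trans ht₀one,
    min ηA (min (ηD / CA) (ηD / c')), lt_min hηA (lt_min (div_pos hηD hCA0) (div_pos hηD hc')),
    max RA (M * RD), lt_max_of_lt_left hRA, fun S hSd hg η hη hηle R hR hreg => ?_⟩
  have hRA_R : RA ≤ R := (le_max_left _ _).trans hR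
  have hRD_R : RD ≤ R / M := by
    rw [le_div_iff₀ hM0]
    calc RD * M = M * RD := mul_comm _ _
      _ ≤ R := (le_max_right _ _).trans hR
  have h1 := hA'' S hSd hg η hη (hηle.trans (min_le_left _ _)) R hRA_R hreg
  have hlevA : CA * η ≤ ηD := by
    have h := hηle.trans ((min_le_right _ _).trans (min_le_left _ _))
    rw [le_div_iff₀ hCA0] at h
    linarith
  have hlevc : c' * η ≤ ηD := by
    have h := hηle.trans ((min_le_right _ _).trans (min_le_right _ _))
    rw [le_div_iff₀ hc'] at h
    linarith
  have h2 := hD'' S hSd.1 hg (CA * η) (by positivity) hlevA (c' * η) (by positivity) hlevc (R / M) hRD_R h1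
  have hCdCA : Cd * CA * t₀ ≤ c / 2 := by
    have h3 : Cd * CA * (c / (2 * Cd * CA + c)) ≤ c / 2 := by
      rw [mul_div_assoc', div_le_iff₀ (by positivity)]
      nlinarith [mul_pos hc hc, mul_pos (mul_pos hCd hCA0) hc]
    exact (mul_le_mul_of_nonneg_left ht₀le (by positivity)).trans h3
  have hsq : t₀ ^ 2 ≤ t₀ := by nlinarith
  have hdef : Cd * (c' * η / t₀ ^ 3) = c / 2 * η := by
    rw [hc'def]
    field_simp
  have hlev : Cd * (t₀ ^ 2 * (CA * η) + c' * η / t₀ ^ 3) ≤ c * η := by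
    have h4 : Cd * (t₀ ^ 2 * (CA * η)) ≤ c / 2 * η := by
      have h5 : Cd * (t₀ ^ 2 * (CA * η)) = Cd * CA * t₀ ^ 2 * η := by ring
      rw [h5]
      apply mul_le_mul_of_nonneg_right _ hη.le
      calc Cd * CA * t₀ ^ 2 ≤ Cd * CA * t₀ := mul_le_mul_of_nonneg_left hsq (by positivity)
        _ ≤ c / 2 := hCdCA
    calc Cd * (t₀ ^ 2 * (CA * η) + c' * η / t₀ ^ 3) = Cd * (t₀ ^ 2 * (CA * η)) + Cd * (c' * η / t₀ ^ 3) := by ring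
      _ ≤ c / 2 * η + c / 2 * η := add_le_add h4 hdef.le
      _ = c * η := by ring
  have hrad : t₀ * (R / M) = t₀ / M * R := by
    field_simp
  rw [hrad] at h2
  exact nearHomH1BDE_mono hlev h2

end Summit.AtomisticToContinuum.Crystallization.Theorems.ChartedZeroExcessLayeredLatticeLiouville

end
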